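import Summits.ResolutionOfSingularities.ResolutionOfSingularities.Theorems.PurelyInseparableDim4PureLeafTransitions
import Summits.ResolutionOfSingularities.ResolutionOfSingularities.Theorems.PurelyInseparableDim4MohAlong
import HarnessLib
import HarnessLib.Audit.Tags

/-!
# Purely inseparable fourfolds — TRANSITIONS of the L-STATES `Θ·(∏_{i∈T}(1+xᵢ) + 1)` under a singleton blow-up
# over `𝔽₂` (cell res-dim4-pi; D3b, case (L) of `HOME/res-dim4-p-10/D3b-PAPER.md` §2)
# [OURS · counted 0 · bookkeeping identities of OUR frame, not about resolution]

Width seat `res-dim4-p-10` (g2).  Second part of the transition table of the paper proof «pure leaves win the global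
game over `𝔽₂`».  An L-STATE is `F = Θ · (∏_{i∈T}(1+xᵢ) + 1)` with `Θ = N(a,e) = ∏ xᵢ^{aᵢ}(1+xᵢ)^{eᵢ}`, ALL `aᵢ, eᵢ`
EVEN (so `Θ` is a square polynomial, inert under the cleaning).  The move: centre `{x_j}` with `2 ≤ a_j`, any
`𝔽₂`-rational reply `b` (`b_j = 0`; `B := {i : bᵢ ≠ 0}` the translated variables):

* `prod_mul_prod` (`N(a,e)·N(a′,e′) = N(a+a′,e+e′)`), `prod_even_eq_expand` (all exponents even ⇒ `N = expand 2 N(a/2,e/2)`),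
  `translate_L` (`translate b (∏_{T}(1+xᵢ) + 1) = N(𝟙_{T∩B}, 𝟙_{T∖B}) + 1`);
* **`pointTransform_singleton_L`** — the uncleaned transform is `Θ″ · (N(𝟙_{T∩B}, 𝟙_{T∖B}) + 1)` with
  `Θ″ = N(a″,e″)` the chart-and-swap of `Θ` (all exponents still even);
* **`step_F_L_persist`** — `T ∩ B = ∅` (no variable of `T` translated): the cleaning deletes nothing, `F′ = Θ″·(∏_{T}(1+xᵢ)+1)`
  is again an L-state with the same `T`;
* **`step_F_L_exit`** — `T ∩ B ≠ ∅`: the cleaning deletes the constant of the bracket and `F′ = Θ″ · N(𝟙_{T∩B}, 𝟙_{T∖B})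
  = N(a″ + 𝟙_{T∩B}, e″ + 𝟙_{T∖B})` is a PRODUCT state again (pure type-A variables on `T ∩ B`, type-B on `T ∖ B`).

Nothing here proves resolution of singularities in dimension ≥ 4 / characteristic `p`; counted 0; AI work, weaker than
expert review. bears_on: LADDER-RESOLUTION:D157-DOOR2 (res-dim4-pi · WORD #60 D3b). Supports
stmt-ResolutionOfSingularities-16155 (helper).
-/

set_option linter.dupNamespace false

open MvPolynomial Finset

open scoped BigOperators

noncomputable section

namespace Summit.ResolutionOfSingularities.ResolutionOfSingularities.Theorems.PIDim4

namespace PureLeafNF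

open Literature.AlgebraicGeometry.Resolution
open Literature.AlgebraicGeometry.Resolution.Hauser2010
open CentreBlowup PthPowerFactor

variable {σ : Type*} [Fintype σ] [DecidableEq σ]

/-! ## 1. Algebra of normal forms -/

omit [DecidableEq σ] in
/-- `N(a,e) · N(a′,e′) = N(a + a′, e + e′)`. [folklore] -/
theorem prod_mul_prod {K : Type*} [CommRing K] (a e a' e' : σ → ℕ) :
    (∏ i, X i ^ a i * (1 + X i) ^ e i : MvPolynomial σ K) * ∏ i, X i ^ a' i * (1 + X i) ^ e' i =
      ∏ i, X i ^ (a i + a' i) * (1 + X i) ^ (e i + e' i) := by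
  rw [← Finset.prod_mul_distrib]
  refine Finset.prod_congr rfl fun i _ => ?_
  rw [pow_add, pow_add]; ring

omit [DecidableEq σ] in
/-- All exponents even ⇒ `N(a,e) = expand 2 N(a/2, e/2)` (a square polynomial). [folklore] -/
theorem prod_even_eq_expand (a e : σ → ℕ) (ha : ∀ i, a i % 2 = 0) (he : ∀ i, e i % 2 = 0) :
    (∏ i, X i ^ a i * (1 + X i) ^ e i : MvPolynomial σ (ZMod 2)) =
      expand 2 (∏ i, X i ^ (a i / 2) * (1 + X i) ^ (e i / 2)) := by
  rw [map_prod]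
  refine Finset.prod_congr rfl fun i _ => ?_
  rw [expand_factor]
  congr 2
  · have := Nat.div_add_mod (a i) 2; have := ha i; omega
  · have := Nat.div_add_mod (e i) 2; have := he i; omega

omit [DecidableEq σ] in
/-- All exponents even ⇒ every monomial of `N(a,e)` is a square. [folklore] -/
theorem forall_dvd_of_mem_support_prod_even (a e : σ → ℕ) (ha : ∀ i, a i % 2 = 0) (he : ∀ i, e i % 2 = 0) :
    ∀ u ∈ (∏ i, X i ^ a i * (1 + X i) ^ e i : MvPolynomial σ (ZMod 2)).support, ∀ k, 2 ∣ u k := by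
  rw [prod_even_eq_expand a e ha he]
  exact forall_dvd_of_mem_support_expand 2 _

/-- **Translating the bracket**: `translate b (∏_{i∈T}(1+xᵢ) + 1) = N(𝟙_{T∩B}, 𝟙_{T∖B}) + 1`, `B = {bᵢ ≠ 0}`. [folklore] -/
theorem translate_L (b : σ → ZMod 2) (T : Finset σ) :
    PointBlowup.translate b ((∏ i, X i ^ (0 : ℕ) * (1 + X i) ^ (if i ∈ T then 1 else 0) :
        MvPolynomial σ (ZMod 2)) + 1) =
      (∏ i, X i ^ (if b i = 0 then 0 else if i ∈ T then 1 else 0) *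
        (1 + X i) ^ (if b i = 0 then (if i ∈ T then 1 else 0) else 0) : MvPolynomial σ (ZMod 2)) + 1 := by
  have h1 : PointBlowup.translate b (1 : MvPolynomial σ (ZMod 2)) = 1 := by
    unfold PointBlowup.translate; rw [map_one]
  rw [MohAlong.translate_add, h1, translate_prod_zmod2]

/-! ## 2. The L-move: uncleaned transform -/

/-- **(L) The uncleaned transform of an L-state** `F = N(a,e)·(∏_{T}(1+xᵢ)+1)`, centre `{x_j}` (`2 ≤ a_j`), reply `b`:
`F⁺ = N(a″,e″) · (N(𝟙_{T∩B}, 𝟙_{T∖B}) + 1)` with `(a″,e″)` the chart-and-swap of `(a,e)`. [folklore] -/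
theorem pointTransform_singleton_L (s : CState σ (ZMod 2)) (a e : σ → ℕ) (T : Finset σ)
    (hF : s.F = (∏ i, X i ^ a i * (1 + X i) ^ e i) *
      ((∏ i, X i ^ (0 : ℕ) * (1 + X i) ^ (if i ∈ T then 1 else 0) : MvPolynomial σ (ZMod 2)) + 1))
    {j : σ} (hj : 2 ≤ a j) (b : σ → ZMod 2) :
    pointTransform 2 {j} j b s =
      (∏ i, X i ^ (if b i = 0 then Function.update a j (a j - 2) i else e i) *
          (1 + X i) ^ (if b i = 0 then e i else Function.update a j (a j - 2) i)) *
        ((∏ i, X i ^ (if b i = 0 then 0 else if i ∈ T then 1 else 0) *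
          (1 + X i) ^ (if b i = 0 then (if i ∈ T then 1 else 0) else 0) : MvPolynomial σ (ZMod 2)) + 1) := by
  unfold pointTransform
  rw [hF, prod_eq_X_sq_mul a e hj, mul_assoc, chartTransform_singleton_mul, MohAlong.translate_mul,
    translate_prod_zmod2, translate_L]

/-! ## 3. The L-move: cleaning -/

/-- The square part of the translated bracket `N(𝟙_A, 𝟙_C) + 1` (`A`, `C` disjoint): `0` if `A ≠ ∅` … [folklore] -/
theorem deletePthPowers_bracket_of_nonempty (A C : Finset σ) {k : σ} (hk : k ∈ A) (hkC : k ∉ C) :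
    deletePthPowers 2 ((∏ i, X i ^ (if i ∈ A then 1 else 0) * (1 + X i) ^ (if i ∈ C then 1 else 0) :
        MvPolynomial σ (ZMod 2)) + 1) =
      ∏ i, X i ^ (if i ∈ A then 1 else 0) * (1 + X i) ^ (if i ∈ C then 1 else 0) := by
  classical
  have h1 : deletePthPowers 2 (1 : MvPolynomial σ (ZMod 2)) = 0 := by
    rw [← C_1, ← monomial_zero', deletePthPowers_monomial, if_pos]
    intro i hi; rw [Finsupp.support_zero] at hi; exact absurd hi (Finset.notMem_empty i)
  have hM := sub_deletePthPowers_of_purelyOdd (σ := σ)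
    (fun i => if i ∈ A then 1 else 0) (fun i => if i ∈ C then 1 else 0) (k := k)
    (by simp [hk]) (by simp [hkC])
  rw [deletePthPowers_add, h1, add_zero]
  exact (sub_eq_zero.mp hM).symm

/-- … and `1` if `A = ∅` (then the cleaning deletes exactly the constant). [folklore] -/
theorem deletePthPowers_bracket_of_empty (C : Finset σ) :
    deletePthPowers 2 ((∏ i, X i ^ (0 : ℕ) * (1 + X i) ^ (if i ∈ C then 1 else 0) :
        MvPolynomial σ (ZMod 2)) + 1) =
      (∏ i, X i ^ (0 : ℕ) * (1 + X i) ^ (if i ∈ C then 1 else 0) : MvPolynomial σ (ZMod 2)) + 1 := by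
  classical
  have h1 : deletePthPowers 2 (1 : MvPolynomial σ (ZMod 2)) = 0 := by
    rw [← C_1, ← monomial_zero', deletePthPowers_monomial, if_pos]
    intro i hi; rw [Finsupp.support_zero] at hi; exact absurd hi (Finset.notMem_empty i)
  have hM := sub_deletePthPowers_of_forall_even (σ := σ) (fun _ => (0 : ℕ)) (fun i => if i ∈ C then 1 else 0)
    (fun _ => rfl)
  have hsq : (∏ i, X i ^ (0 : ℕ) * (1 + X i) ^ ((if i ∈ C then 1 else 0) - (if i ∈ C then 1 else 0) % 2) :
      MvPolynomial σ (ZMod 2)) = 1 := by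
    refine Finset.prod_eq_one fun i _ => ?_
    split_ifs <;> simp
  rw [hsq] at hM
  -- `M − del M = 1`, i.e. `del M = M − 1 = M + 1` in characteristic 2
  have hneg : (-1 : MvPolynomial σ (ZMod 2)) = 1 := by
    rw [← C_1, ← C_neg]; rfl
  rw [deletePthPowers_add, h1, add_zero]
  have h2 : deletePthPowers 2 (∏ i, X i ^ (0 : ℕ) * (1 + X i) ^ (if i ∈ C then 1 else 0) :
      MvPolynomial σ (ZMod 2)) =
      (∏ i, X i ^ (0 : ℕ) * (1 + X i) ^ (if i ∈ C then 1 else 0) : MvPolynomial σ (ZMod 2)) - 1 := by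
    linear_combination (-1 : MvPolynomial σ (ZMod 2)) * hM
  rw [h2, sub_eq_add_neg, hneg]

/-! ## 4. The L-move: the two outcomes -/

omit [Fintype σ] in
/-- The chart-and-swap of an all-even exponent pair is all even. [folklore] -/
theorem even_chartSwap {a e : σ → ℕ} (ha : ∀ i, a i % 2 = 0) (he : ∀ i, e i % 2 = 0) (j : σ) (b : σ → ZMod 2) :
    (∀ i, (if b i = 0 then Function.update a j (a j - 2) i else e i) % 2 = 0) ∧
      ∀ i, (if b i = 0 then e i else Function.update a j (a j - 2) i) % 2 = 0 := by
  have hupd : ∀ i, Function.update a j (a j - 2) i % 2 = 0 := fun i => by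
    by_cases hij : i = j
    · subst hij; rw [Function.update_self]; have := ha i; omega
    · rw [Function.update_of_ne hij]; exact ha i
  refine ⟨fun i => ?_, fun i => ?_⟩ <;> split_ifs
  · exact hupd i
  · exact he i
  · exact he i
  · exact hupd i

/-- Rewriting the translated bracket's exponents through `A = T ∩ B`, `C = T ∖ B`. [folklore] -/
theorem bracket_eq_filter (b : σ → ZMod 2) (T : Finset σ) :
    (∏ i, X i ^ (if b i = 0 then 0 else if i ∈ T then 1 else 0) *
        (1 + X i) ^ (if b i = 0 then (if i ∈ T then 1 else 0) else 0) : MvPolynomial σ (ZMod 2)) =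
      ∏ i, X i ^ (if i ∈ T.filter (fun i => b i ≠ 0) then 1 else 0) *
        (1 + X i) ^ (if i ∈ T.filter (fun i => b i = 0) then 1 else 0) := by
  refine Finset.prod_congr rfl fun i _ => ?_
  simp only [Finset.mem_filter]
  by_cases hb : b i = 0 <;> by_cases hT : i ∈ T <;> simp [hb, hT]

/-- **(L, exit) `T ∩ B ≠ ∅`: the successor is a PRODUCT state.** If some `k ∈ T` is translated (`b_k ≠ 0`), then
`F′ = N(a″,e″) · N(𝟙_{T∩B}, 𝟙_{T∖B}) = N(a″ + 𝟙_{T∩B}, e″ + 𝟙_{T∖B})`. [folklore] -/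
theorem step_F_L_exit (s : CState σ (ZMod 2)) (a e : σ → ℕ) (ha : ∀ i, a i % 2 = 0) (he : ∀ i, e i % 2 = 0)
    (T : Finset σ)
    (hF : s.F = (∏ i, X i ^ a i * (1 + X i) ^ e i) *
      ((∏ i, X i ^ (0 : ℕ) * (1 + X i) ^ (if i ∈ T then 1 else 0) : MvPolynomial σ (ZMod 2)) + 1))
    {j : σ} (hj : 2 ≤ a j) (b : σ → ZMod 2) {k : σ} (hkT : k ∈ T) (hbk : b k ≠ 0) :
    (step 2 {j} j b s).F =
      ∏ i, X i ^ ((if b i = 0 then Function.update a j (a j - 2) i else e i) +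
            (if i ∈ T.filter (fun i => b i ≠ 0) then 1 else 0)) *
        (1 + X i) ^ ((if b i = 0 then e i else Function.update a j (a j - 2) i) +
            (if i ∈ T.filter (fun i => b i = 0) then 1 else 0)) := by
  change deletePthPowers 2 (pointTransform 2 {j} j b s) = _
  obtain ⟨ha'', he''⟩ := even_chartSwap ha he j b
  rw [pointTransform_singleton_L s a e T hF hj b,
    deletePthPowers_mul_of_forall_dvd 2 _ _ (forall_dvd_of_mem_support_prod_even _ _ ha'' he''),
    bracket_eq_filter, deletePthPowers_bracket_of_nonempty (T.filter fun i => b i ≠ 0) (T.filter fun i => b i = 0)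
      (Finset.mem_filter.mpr ⟨hkT, hbk⟩) (fun h => hbk (Finset.mem_filter.mp h).2), prod_mul_prod]

/-- **(L, persist) `T ∩ B = ∅`: the successor is the SAME bracket with the new square factor.** If no variable of `T`
is translated, `F′ = N(a″,e″) · (∏_{T}(1+xᵢ) + 1)`. [folklore] -/
theorem step_F_L_persist (s : CState σ (ZMod 2)) (a e : σ → ℕ) (ha : ∀ i, a i % 2 = 0) (he : ∀ i, e i % 2 = 0)
    (T : Finset σ)
    (hF : s.F = (∏ i, X i ^ a i * (1 + X i) ^ e i) *
      ((∏ i, X i ^ (0 : ℕ) * (1 + X i) ^ (if i ∈ T then 1 else 0) : MvPolynomial σ (ZMod 2)) + 1))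
    {j : σ} (hj : 2 ≤ a j) (b : σ → ZMod 2) (hT : ∀ i ∈ T, b i = 0) :
    (step 2 {j} j b s).F =
      (∏ i, X i ^ (if b i = 0 then Function.update a j (a j - 2) i else e i) *
          (1 + X i) ^ (if b i = 0 then e i else Function.update a j (a j - 2) i)) *
        ((∏ i, X i ^ (0 : ℕ) * (1 + X i) ^ (if i ∈ T then 1 else 0) : MvPolynomial σ (ZMod 2)) + 1) := by
  change deletePthPowers 2 (pointTransform 2 {j} j b s) = _
  obtain ⟨ha'', he''⟩ := even_chartSwap ha he j b
  have hbr : (∏ i, X i ^ (if b i = 0 then 0 else if i ∈ T then 1 else 0) *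
      (1 + X i) ^ (if b i = 0 then (if i ∈ T then 1 else 0) else 0) : MvPolynomial σ (ZMod 2)) =
      ∏ i, X i ^ (0 : ℕ) * (1 + X i) ^ (if i ∈ T then 1 else 0) := by
    refine Finset.prod_congr rfl fun i _ => ?_
    by_cases hb : b i = 0
    · simp [hb]
    · have hiT : i ∉ T := fun h => hb (hT i h)
      simp [hb, hiT]
  rw [pointTransform_singleton_L s a e T hF hj b,
    deletePthPowers_mul_of_forall_dvd 2 _ _ (forall_dvd_of_mem_support_prod_even _ _ ha'' he''), hbr,
    deletePthPowers_bracket_of_empty]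

end PureLeafNF

end Summit.ResolutionOfSingularities.ResolutionOfSingularities.Theorems.PIDim4

end
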